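import Mathlib
import HarnessLib
import Summits.RiemannHypothesis.RiemannHypothesis.Theses.RuelleBand
import Summits.RiemannHypothesis.RiemannHypothesis.Theorems.RuelleBandLasotaYorkeDefs
import Summits.RiemannHypothesis.RiemannHypothesis.Theorems.RuelleBandAsymptoticCriticalLineLasotaYorkeSeminormed
import Literature.NumberTheory.Automorphic.MeyerArchOrbit
import Literature.NumberTheory.Automorphic.MeyerRatSpectralRealisation

/-!
# RuelleBand / `AsymptoticCriticalLine`: the BRIDGE from a Lasota–Yorke landing datum on Meyer's `H⁰₋(ℚ)` to the crux

Route `RiemannHypothesis/RuelleBand`, crux item stmt-RiemannHypothesis-2063 (`AsymptoticCriticalLine`),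
line `interior-edge-split`, helper file (`--supports`; registered periphery stub
`asymptoticCriticalLine_of_isMeyerLasotaYorkeDatum`). Everything is proved; no definitions.

`asymptoticCriticalLine_of_isMeyerLasotaYorkeDatum` — for every measure `μ` on `𝔸_ℚ`, every
positive-semidefinite sesquilinear form `core` on Meyer's coinvariant space `H⁰₋(ℚ) = Meyer.HzeroMinus ℚ μ`,
every weak seminorm `Nw` and every time `t₀`: `RuelleBand.IsMeyerLasotaYorkeDatum μ core Nw t₀` (the typed
landing predicate of the programme item `MeyerLasotaYorke`, stmt-RiemannHypothesis-11050, file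
`RuelleBandLasotaYorkeDefs.lean`) implies the crux `AsymptoticCriticalLine`. So the crux — and with it
route Strip's `StripZeroFreeStrip` (stmt-10660, `edgeZeroFreeStrip_of_acl`) and the line's interior stub —
is reduced IN LEAN to exhibiting ONE pinned datum `(core, Nw, t₀)` with that property; no operator theory
and no bookkeeping remain. (Honesty: the `∃`-version of the datum is equivalent to the crux,
`lasotaYorkeRealisation_of_asymptoticCriticalLine`; the datum must be constructed, not posited.)

`asymptoticCriticalLine_of_nondegenerate_datum` — NON-DEGENERACY FORM: since Meyer's Theorem 5.11 is
PROVED in the tree (`Meyer.spectralRealisation_rat_holds`; we use its lower bound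
`Meyer.analyticOrderAt_completedZeta_le_algMultiplicity`), for the self-dual Haar measure every strip
zero `s` of `ζ` HAS a joint `|x|^s`-eigenvector of `π₋` (`RuelleBand.exists_normChar_eigenvector`, via
the abelian joint-spectrum lemma and positivity of `ord_s Λ`), and by the dictionary lemma
`RuelleBand.meyerScaling_apply_of_normChar` it is a `T_t`-eigenvector of exponent `s - 1/2`; so the
eigenvector clause of the datum reduces to "the pinned strong seminorm does not vanish on Meyer's
joint eigenvectors" (`RuelleBand.eigenClause_of_nondegenerate`), and the crux follows from the first
five clauses of the datum plus that non-degeneracy. The constructor of stmt-11050 never has to exhibit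
an eigenvector.

PROOF. Equip `H⁰₋(ℚ)` with the seminormed inner-product structure of `core`
(`InnerProductSpace.Core.toSeminormedAddCommGroup`, `InnerProductSpace.ofCore`; the ambient quotient
topology of `H⁰₋` is NOT used — the `‖·‖_s`-topology is pinned as a local instance), turn the bounded
linear maps `T_t = RuelleBand.meyerScaling μ t` (`t ≥ 0`) into continuous linear maps
(`LinearMap.mkContinuous`; `T_t := 0` for `t < 0`, never used), transfer the semigroup law
`T_{s+t} = T_s ∘ T_t` (`RuelleBand.meyerScaling_add`: `π₋` is a representation and the archimedean
exponential classes are a one-parameter subgroup, `Meyer.archExpClass_add` from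
`Literature/NumberTheory/Automorphic/MeyerArchOrbit.lean`), the power identity, the
Lasota–Yorke inequality and the eigenvector clause verbatim, and apply the seminormed engine
`asymptoticCriticalLine_of_lasotaYorkeSeminormed`.
-/

noncomputable section

-- D-0017: `Summit.<S>.<S>.…` is the designed namespace of a single-problem summit.
set_option linter.dupNamespace false

namespace Summit.RiemannHypothesis.RiemannHypothesis.Theorems

open Literature.NumberTheory.Automorphic MeasureTheory NumberField
open Summit.RiemannHypothesis.RiemannHypothesis.Theses.RuelleBand (AsymptoticCriticalLine)

section Semigroup

variable [MeasurableSpace (AdeleRing (𝓞 ℚ) ℚ)]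

/-- Semigroup law of the half-density scaling: `T_{s+t} = T_s ∘ T_t`. [folklore] -/
theorem RuelleBand.meyerScaling_add (μ : Measure (AdeleRing (𝓞 ℚ) ℚ)) (s t : ℝ) :
    RuelleBand.meyerScaling μ (s + t) = RuelleBand.meyerScaling μ s ∘ₗ RuelleBand.meyerScaling μ t := by
  simp only [RuelleBand.meyerScaling, RuelleBand.archDir_add, Meyer.archExpClass_add, map_mul,
    LinearMap.smul_comp, LinearMap.comp_smul, smul_smul, Module.End.mul_eq_comp]
  congr 1
  rw [← Complex.ofReal_mul, ← Real.exp_add]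
  congr 2
  ring

end Semigroup


section Dictionary

open scoped Classical

/-- For `ℚ` the archimedean exponential class of parameter `t` has idele class norm `e^t`
(one real place, no complex place; `Meyer.classNorm_archExpClass`). [folklore] -/
theorem RuelleBand.classNorm_archExpClass_archDir (t : ℝ) :
    Meyer.classNorm ℚ (Meyer.archExpClass ℚ (RuelleBand.archDir t)) = Real.exp t := by
  rw [Meyer.classNorm_archExpClass]
  have h1 : (∏ w : {w : NumberField.InfinitePlace ℚ // w.IsReal}, Real.exp ((RuelleBand.archDir t).1 w)) =
      Real.exp t := by
    haveI : Unique {w : NumberField.InfinitePlace ℚ // w.IsReal} :=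
      { default := ⟨Rat.infinitePlace, Rat.isReal_infinitePlace⟩
        uniq := fun w => Subsingleton.elim _ _ }
    rw [Fintype.prod_unique]
    rfl
  have h2 : (∏ w : {w : NumberField.InfinitePlace ℚ // w.IsComplex},
      Real.exp (2 * ((RuelleBand.archDir t).2 w).re)) = 1 := by
    haveI : IsEmpty {w : NumberField.InfinitePlace ℚ // w.IsComplex} :=
      ⟨fun w => NumberField.InfinitePlace.not_isComplex_iff_isReal.2
        (by rw [Subsingleton.elim w.1 Rat.infinitePlace]; exact Rat.isReal_infinitePlace) w.2⟩
    exact Fintype.prod_empty _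
  rw [h1, h2, mul_one]

variable [MeasurableSpace (AdeleRing (𝓞 ℚ) ℚ)]

/-- **Dictionary.** A joint eigenvector of Meyer's `π₋` with the unramified quasi-character
`|x|^s` (`Meyer.normChar ℚ s`, the vocabulary of the named fact `Meyer.spectralRealisation_rat`) is a
joint eigenvector of the half-density scaling `T_t` with exponent `s - 1/2`:
`T_t v = e^{t(s - 1/2)} v` — the eigenvector clause of `RuelleBand.IsMeyerLasotaYorkeDatum` is
exactly "Meyer's eigenvectors, of non-zero strong seminorm". [folklore] -/
theorem RuelleBand.meyerScaling_apply_of_normChar (μ : Measure (AdeleRing (𝓞 ℚ) ℚ)) {s : ℂ}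
    {v : Meyer.HzeroMinus ℚ μ}
    (hv : ∀ g : IdeleClassGroup ℚ, Meyer.piMinus ℚ μ g v = Meyer.normChar ℚ s g • v) (t : ℝ) :
    RuelleBand.meyerScaling μ t v = Complex.exp (↑t * (s - 1 / 2)) • v := by
  simp only [RuelleBand.meyerScaling, LinearMap.smul_apply, hv, smul_smul, Meyer.normChar,
    RuelleBand.classNorm_archExpClass_archDir]
  congr 1
  have hexp : (((Real.exp t : ℝ) : ℂ)) ^ s = Complex.exp (↑t * s) := by
    rw [Complex.cpow_def_of_ne_zero (by exact_mod_cast (Real.exp_pos t).ne'), ← Complex.ofReal_log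
      (Real.exp_pos t).le, Real.log_exp]
  rw [hexp, Complex.ofReal_exp, ← Complex.exp_add]
  congr 1
  push_cast
  ring

end Dictionary

/-- **BRIDGE: a Lasota–Yorke landing datum on Meyer's `H⁰₋(ℚ)` proves the crux.** If, for some measure
`μ` on `𝔸_ℚ`, a pinned positive-semidefinite form `core` (strong seminorm), a weak seminorm `Nw` and a
time `t₀` satisfy `RuelleBand.IsMeyerLasotaYorkeDatum μ core Nw t₀`, then `AsymptoticCriticalLine`
holds (seminormed Lasota–Yorke engine on the `‖·‖_s`-structure). [folklore] -/
theorem asymptoticCriticalLine_of_isMeyerLasotaYorkeDatum :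
    ∀ [MeasurableSpace (NumberField.AdeleRing (NumberField.RingOfIntegers ℚ) ℚ)] (μ : MeasureTheory.Measure (NumberField.AdeleRing (NumberField.RingOfIntegers ℚ) ℚ)) (core : PreInnerProductSpace.Core ℂ (Literature.NumberTheory.Automorphic.Meyer.HzeroMinus ℚ μ)) (Nw : Seminorm ℂ (Literature.NumberTheory.Automorphic.Meyer.HzeroMinus ℚ μ)) (t₀ : ℝ), Summit.RiemannHypothesis.RiemannHypothesis.Theorems.RuelleBand.IsMeyerLasotaYorkeDatum μ core Nw t₀ → Summit.RiemannHypothesis.RiemannHypothesis.Theses.RuelleBand.AsymptoticCriticalLine := by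
  intro _ μ core Nw t₀ h
  letI i1 : SeminormedAddCommGroup (Meyer.HzeroMinus ℚ μ) :=
    InnerProductSpace.Core.toSeminormedAddCommGroup (c := core)
  letI i2 : InnerProductSpace ℂ (Meyer.HzeroMinus ℚ μ) := InnerProductSpace.ofCore core
  -- the topology we mean is the `‖·‖_s`-topology, not the ambient quotient topology of `H⁰₋`
  letI iT : TopologicalSpace (Meyer.HzeroMinus ℚ μ) :=
    i1.toPseudoMetricSpace.toUniformSpace.toTopologicalSpace
  obtain ⟨ht₀, ⟨c, hc⟩, hbdd, hnet, hLY, heig⟩ := h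
  -- bounded operators for `t ≥ 0`
  choose! M hM using hbdd
  let T : ℝ → (Meyer.HzeroMinus ℚ μ) →L[ℂ] (Meyer.HzeroMinus ℚ μ) := fun t =>
    if ht : 0 ≤ t then by
      have A := (RuelleBand.meyerScaling μ t).mkContinuous (M t) (hM t ht)
      exact A
    else 0
  have hT : ∀ t : ℝ, 0 ≤ t → ∀ f : (Meyer.HzeroMinus ℚ μ), T t f = RuelleBand.meyerScaling μ t f := by
    intro t ht f
    simp only [T, dif_pos ht]
    rfl
  -- semigroup law on `t ≥ 0`
  have hsemi : ∀ s t : ℝ, 0 ≤ s → 0 ≤ t → T (s + t) = (T s).comp (T t) := by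
    intro s t hs ht
    ext f
    rw [ContinuousLinearMap.comp_apply, hT _ (add_nonneg hs ht), hT s hs, hT t ht,
      RuelleBand.meyerScaling_add, LinearMap.comp_apply]
  -- powers at `t₀`
  have hpow : ∀ (n : ℕ) (f : (Meyer.HzeroMinus ℚ μ)), (T t₀ ^ n) f = (RuelleBand.meyerScaling μ t₀ ^ n) f := by
    intro n
    induction n with
    | zero => intro f; rfl
    | succ k ih =>
      intro f
      rw [pow_succ, pow_succ, ContinuousLinearMap.mul_def, ContinuousLinearMap.comp_apply,
        hT t₀ ht₀.le, ih, Module.End.mul_apply]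
  have hLY' : ∀ ε : ℝ, 0 < ε → ∃ C : ℝ, ∀ n : ℕ, ∃ R : ℝ, ∀ f : (Meyer.HzeroMinus ℚ μ),
      ‖(T t₀ ^ n) f‖ ≤ C * Real.exp ((n : ℝ) * ε * t₀) * ‖f‖ + R * Nw f := by
    intro ε hε
    obtain ⟨C, hC⟩ := hLY ε hε
    refine ⟨C, fun n => ?_⟩
    obtain ⟨R, hR⟩ := hC n
    exact ⟨R, fun f => by rw [hpow]; exact hR f⟩
  have heig' : ∀ s : ℂ, riemannZeta s = 0 → 0 < s.re → s.re < 1 →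
      ∃ v : (Meyer.HzeroMinus ℚ μ), ‖v‖ ≠ 0 ∧ ∀ t : ℝ, 0 ≤ t → T t v = Complex.exp (↑t * (s - 1 / 2)) • v := by
    intro s hs h0 h1
    obtain ⟨v, hv0, hv⟩ := heig s hs h0 h1
    exact ⟨v, hv0, fun t ht => by rw [hT t ht]; exact hv t ht⟩
  exact asymptoticCriticalLine_of_lasotaYorkeSeminormed (Meyer.HzeroMinus ℚ μ) inferInstance inferInstance Nw T t₀ c ht₀ hc
    hsemi hnet hLY' heig'


/-! ## Meyer's eigenvectors: the last conjunct of the datum from NON-DEGENERACY of the pinned seminorm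

Meyer's Theorem 5.11 is PROVED in the tree (`Meyer.spectralRealisation_rat_holds`,
`Literature/NumberTheory/Automorphic/MeyerRatSpectralRealisation.lean`; we use its lower bound
`Meyer.analyticOrderAt_completedZeta_le_algMultiplicity`). Hence for the self-dual Haar measure every
zero of `ζ` in the open strip HAS a joint `|x|^s`-eigenvector of `π₋`, and the eigenvector clause of
`RuelleBand.IsMeyerLasotaYorkeDatum` reduces to: the pinned strong seminorm does not vanish on Meyer's
joint eigenvectors. The two representation-theoretic lemmas are stated with the commutation of the
operators as an explicit hypothesis (for the concrete group `C_ℚ` this avoids synthesising a second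
monoid structure). -/

section MeyerEigenvectors

section Commute

variable {k G V : Type*} [Field k] [Monoid G] [AddCommGroup V] [Module k V]

/-- Commuting representation operators preserve every joint generalised eigenspace (the
commutative-`G` lemma `jointGenEigenspace_le_comap` with the commutation as an explicit hypothesis,
so that no `CommMonoid` instance has to be synthesised for concrete `G`). [folklore] -/
theorem RuelleBand.jointGenEigenspace_le_comap_of_commute (ρ : Representation k G V)
    (hcomm : ∀ g h : G, Commute (ρ g) (ρ h)) (χ : G → k) (h : G) :
    jointGenEigenspace ρ χ ≤ (jointGenEigenspace ρ χ).comap (ρ h) := by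
  intro v hv
  rw [Submodule.mem_comap]
  simp only [jointGenEigenspace, Submodule.mem_iInf] at hv ⊢
  intro g
  exact Module.End.mapsTo_maxGenEigenspace_of_comm (hcomm g h) (χ g) (hv g)

/-- Non-zero algebraic multiplicity gives a joint eigenvector, for a representation by pairwise
COMMUTING operators (explicit-hypothesis form of `mem_jointSpectrum_of_algMultiplicity_ne_zero`).
[folklore] -/
theorem RuelleBand.mem_jointSpectrum_of_algMultiplicity_ne_zero_of_commute (ρ : Representation k G V)
    (hcomm : ∀ g h : G, Commute (ρ g) (ρ h)) (χ : G → k)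
    (h : algMultiplicity ρ χ ≠ 0) : χ ∈ jointSpectrum ρ := by
  obtain ⟨W, hfin, hW, hne⟩ : ∃ W : Submodule k V, FiniteDimensional k W ∧
      (∀ g : G, W ≤ W.comap (ρ g)) ∧ W ⊓ jointGenEigenspace ρ χ ≠ ⊥ := by
    by_contra hcon
    push Not at hcon
    exact h ((algMultiplicity_eq_zero_iff_forall ρ χ).mpr hcon)
  haveI := hfin
  have hc : ∀ g h' : G, Commute (ρ g - χ g • (1 : Module.End k V)) (ρ h' - χ h' • (1 : Module.End k V)) :=
    fun g h' => ((hcomm g h').sub_right (Commute.smul_right (Commute.one_right _) _)).sub_left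
      (Commute.smul_left (Commute.one_left _) _)
  have hinv : ∀ g : G, W ⊓ jointGenEigenspace ρ χ ≤
      (W ⊓ jointGenEigenspace ρ χ).comap (ρ g - χ g • (1 : Module.End k V)) := by
    intro g v hv
    rw [Submodule.mem_comap, LinearMap.sub_apply, LinearMap.smul_apply, Module.End.one_apply]
    exact Submodule.sub_mem _ ⟨hW g hv.1, RuelleBand.jointGenEigenspace_le_comap_of_commute ρ hcomm χ g hv.2⟩
      (Submodule.smul_mem _ _ hv)
  have hnil : ∀ g : G, ∀ v ∈ W ⊓ jointGenEigenspace ρ χ, ∃ n : ℕ,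
      ((ρ g - χ g • (1 : Module.End k V)) ^ n) v = 0 :=
    fun g v hv => (mem_jointGenEigenspace_iff ρ χ v).mp hv.2 g
  obtain ⟨v, -, hv0, hTv⟩ := Meyer.exists_common_kernel_vector
    (fun g : G => ρ g - χ g • (1 : Module.End k V)) hc
    (W ⊓ jointGenEigenspace ρ χ) inferInstance hinv hnil hne
  refine ⟨v, hv0, fun g => ?_⟩
  have h := hTv g
  simp only [LinearMap.sub_apply, LinearMap.smul_apply, Module.End.one_apply, sub_eq_zero] at h
  exact h


end Commute

/-- For a zero of `ζ` in the open critical strip the completed zeta function `Λ` vanishes there to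
POSITIVE (analytic) order. [folklore] -/
theorem RuelleBand.analyticOrderAt_completedZeta_ne_zero {s : ℂ} (hs : riemannZeta s = 0)
    (h0 : 0 < s.re) (h1 : s.re < 1) : analyticOrderAt completedRiemannZeta s ≠ 0 := by
  have hs0 : s ≠ 0 := fun h => by rw [h, Complex.zero_re] at h0; exact lt_irrefl _ h0
  have hs1 : s ≠ 1 := fun h => by rw [h, Complex.one_re] at h1; exact lt_irrefl _ h1
  have hΛ : completedRiemannZeta s = 0 := by
    have h := riemannZeta_def_of_ne_zero hs0
    rw [hs] at h
    have hG : Complex.Gammaℝ s ≠ 0 := Complex.Gammaℝ_ne_zero_of_re_pos h0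
    rcases div_eq_zero_iff.1 h.symm with h' | h'
    · exact h'
    · exact absurd h' hG
  have hopen : IsOpen ({0, 1}ᶜ : Set ℂ) := (Set.toFinite _).isClosed.isOpen_compl
  have hmem : ({0, 1}ᶜ : Set ℂ) ∈ nhds s := hopen.mem_nhds (by simp [hs0, hs1])
  have hdiff : DifferentiableOn ℂ completedRiemannZeta ({0, 1}ᶜ : Set ℂ) := by
    intro z hz
    simp only [Set.mem_compl_iff, Set.mem_insert_iff, Set.mem_singleton_iff, not_or] at hz
    exact (differentiableAt_completedZeta hz.1 hz.2).differentiableWithinAt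
  have han : AnalyticAt ℂ completedRiemannZeta s := hdiff.analyticAt hmem
  rw [Ne, han.analyticOrderAt_eq_zero, not_not]
  exact hΛ

/-- Commutation of Meyer's operators `π₋(g)`, `g ∈ C_ℚ` (the idele class group is abelian).
[folklore] -/
theorem RuelleBand.commute_piMinus [MeasurableSpace (AdeleRing (𝓞 ℚ) ℚ)]
    (μ : Measure (AdeleRing (𝓞 ℚ) ℚ)) (g h : IdeleClassGroup ℚ) :
    Commute (Meyer.piMinus ℚ μ g) (Meyer.piMinus ℚ μ h) := by
  show (Meyer.piMinus ℚ μ) g * (Meyer.piMinus ℚ μ) h = (Meyer.piMinus ℚ μ) h * (Meyer.piMinus ℚ μ) g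
  rw [← map_mul, ← map_mul]
  exact congrArg _ (mul_comm g h)

/-- **Meyer's eigenvectors exist (PROVED in tree).** For the self-dual Haar measure `μ` on `𝔸_ℚ` and
every zero `s` of `ζ` in the open strip, `π₋` has a joint eigenvector with the quasi-character
`|x|^s`: Meyer's Theorem 5.11 (`Meyer.spectralRealisation_rat_holds`: `mult(|x|^s, π₋) = ord_s Λ`),
positivity of `ord_s Λ`, and the abelian joint-spectrum lemma
(`RuelleBand.mem_jointSpectrum_of_algMultiplicity_ne_zero_of_commute`; the plain abelian form is
`Literature.NumberTheory.Automorphic.mem_jointSpectrum_of_algMultiplicity_ne_zero`). [cite: Meyer2005, Thm 5.11] -/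
theorem RuelleBand.exists_normChar_eigenvector [MeasurableSpace (AdeleRing (𝓞 ℚ) ℚ)]
    [BorelSpace (AdeleRing (𝓞 ℚ) ℚ)] (μ : Measure (AdeleRing (𝓞 ℚ) ℚ)) [μ.IsAddHaarMeasure]
    (hμ : μ (adeleFundamentalDomain ℚ) = 1) {s : ℂ} (hs : riemannZeta s = 0) (h0 : 0 < s.re)
    (h1 : s.re < 1) :
    ∃ v : Meyer.HzeroMinus ℚ μ, v ≠ 0 ∧
      ∀ g : IdeleClassGroup ℚ, Meyer.piMinus ℚ μ g v = Meyer.normChar ℚ s g • v := by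
  have hs0 : s ≠ 0 := fun h => by rw [h, Complex.zero_re] at h0; exact lt_irrefl _ h0
  have hs1 : s ≠ 1 := fun h => by rw [h, Complex.one_re] at h1; exact lt_irrefl _ h1
  have hle := Meyer.analyticOrderAt_completedZeta_le_algMultiplicity μ hμ hs0 hs1
  have hne : algMultiplicity (Meyer.piMinus ℚ μ) (Meyer.normChar ℚ s) ≠ 0 := by
    intro h0'
    rw [h0', nonpos_iff_eq_zero] at hle
    exact RuelleBand.analyticOrderAt_completedZeta_ne_zero hs h0 h1 hle
  exact (mem_jointSpectrum_iff _ _).1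
    (RuelleBand.mem_jointSpectrum_of_algMultiplicity_ne_zero_of_commute (Meyer.piMinus ℚ μ)
      (RuelleBand.commute_piMinus μ) (Meyer.normChar ℚ s) hne)


/-- **The eigenvector clause from non-degeneracy.** For the self-dual Haar measure `μ` and a pinned
positive-semidefinite form `core` on `H⁰₋(ℚ)` whose seminorm does not vanish on any joint
`|x|^s`-eigenvector of `π₋` (`s` a zero of `ζ` in the open strip), the last conjunct of
`RuelleBand.IsMeyerLasotaYorkeDatum` holds: every such zero has a `T_t`-eigenvector of exponent
`s - 1/2` and non-zero strong seminorm (Meyer's theorem + the dictionary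
`RuelleBand.meyerScaling_apply_of_normChar`). [cite: Meyer2005, Thm 5.11] -/
theorem RuelleBand.eigenClause_of_nondegenerate [MeasurableSpace (AdeleRing (𝓞 ℚ) ℚ)]
    [BorelSpace (AdeleRing (𝓞 ℚ) ℚ)] (μ : Measure (AdeleRing (𝓞 ℚ) ℚ)) [μ.IsAddHaarMeasure]
    (hμ : μ (adeleFundamentalDomain ℚ) = 1)
    (core : PreInnerProductSpace.Core ℂ (Meyer.HzeroMinus ℚ μ))
    (hnd : letI : SeminormedAddCommGroup (Meyer.HzeroMinus ℚ μ) :=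
        InnerProductSpace.Core.toSeminormedAddCommGroup (c := core)
      ∀ (s : ℂ) (v : Meyer.HzeroMinus ℚ μ), riemannZeta s = 0 → 0 < s.re → s.re < 1 → v ≠ 0 →
        (∀ g : IdeleClassGroup ℚ, Meyer.piMinus ℚ μ g v = Meyer.normChar ℚ s g • v) → ‖v‖ ≠ 0) :
    letI : SeminormedAddCommGroup (Meyer.HzeroMinus ℚ μ) :=
      InnerProductSpace.Core.toSeminormedAddCommGroup (c := core)
    ∀ s : ℂ, riemannZeta s = 0 → 0 < s.re → s.re < 1 →
      ∃ v : Meyer.HzeroMinus ℚ μ, ‖v‖ ≠ 0 ∧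
        ∀ t : ℝ, 0 ≤ t → RuelleBand.meyerScaling μ t v = Complex.exp (↑t * (s - 1 / 2)) • v := by
  intro s hs h0 h1
  obtain ⟨v, hv0, hv⟩ := RuelleBand.exists_normChar_eigenvector μ hμ hs h0 h1
  exact ⟨v, hnd s v hs h0 h1 hv0 hv, fun t _ => RuelleBand.meyerScaling_apply_of_normChar μ hv t⟩

/-- **BRIDGE, non-degeneracy form.** For the self-dual Haar measure `μ`, a pinned datum
`(core, Nw, t₀)` on Meyer's `H⁰₋(ℚ)` satisfying the first five clauses of
`RuelleBand.IsMeyerLasotaYorkeDatum` (positive time, `Nw ≤ c‖·‖_s`, bounded `T_t`, compact embedding,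
a-priori Lasota–Yorke for every `ε`) and whose strong seminorm is non-degenerate on Meyer's joint
`|x|^s`-eigenvectors (strip zeros `s`) proves the crux — the constructor never has to exhibit an
eigenvector, Meyer's proved theorem supplies them. [cite: Meyer2005, Thm 5.11] -/
theorem asymptoticCriticalLine_of_nondegenerate_datum [MeasurableSpace (AdeleRing (𝓞 ℚ) ℚ)]
    [BorelSpace (AdeleRing (𝓞 ℚ) ℚ)] (μ : Measure (AdeleRing (𝓞 ℚ) ℚ)) [μ.IsAddHaarMeasure]
    (hμ : μ (adeleFundamentalDomain ℚ) = 1)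
    (core : PreInnerProductSpace.Core ℂ (Meyer.HzeroMinus ℚ μ))
    (Nw : Seminorm ℂ (Meyer.HzeroMinus ℚ μ)) (t₀ : ℝ)
    (h : letI : SeminormedAddCommGroup (Meyer.HzeroMinus ℚ μ) :=
        InnerProductSpace.Core.toSeminormedAddCommGroup (c := core)
      0 < t₀ ∧
      (∃ c : ℝ, ∀ f, Nw f ≤ c * ‖f‖) ∧
      (∀ t : ℝ, 0 ≤ t → ∃ M : ℝ, ∀ f, ‖RuelleBand.meyerScaling μ t f‖ ≤ M * ‖f‖) ∧
      (∀ η : ℝ, 0 < η → ∃ F : Finset (Meyer.HzeroMinus ℚ μ), ∀ f, ‖f‖ ≤ 1 → ∃ g ∈ F, Nw (f - g) < η) ∧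
      (∀ ε : ℝ, 0 < ε → ∃ C : ℝ, ∀ n : ℕ, ∃ R : ℝ, ∀ f,
          ‖((RuelleBand.meyerScaling μ t₀) ^ n) f‖ ≤ C * Real.exp (n * ε * t₀) * ‖f‖ + R * Nw f) ∧
      (∀ (s : ℂ) (v : Meyer.HzeroMinus ℚ μ), riemannZeta s = 0 → 0 < s.re → s.re < 1 → v ≠ 0 →
        (∀ g : IdeleClassGroup ℚ, Meyer.piMinus ℚ μ g v = Meyer.normChar ℚ s g • v) → ‖v‖ ≠ 0)) :
    AsymptoticCriticalLine := by
  obtain ⟨ht₀, hc, hbdd, hnet, hLY, hnd⟩ := h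
  exact asymptoticCriticalLine_of_isMeyerLasotaYorkeDatum μ core Nw t₀
    ⟨ht₀, hc, hbdd, hnet, hLY, RuelleBand.eigenClause_of_nondegenerate μ hμ core hnd⟩

end MeyerEigenvectors

end Summit.RiemannHypothesis.RiemannHypothesis.Theorems

end
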